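import Summits.Ventures.PercRepro.S2QuartMultiplicityA

/-!
# PercRepro — S2: THE QUARTIC MULTIPLICITY — `ν + 3·C(ν, 2) + 3·C(ν, 3) + 2·C(ν, 4)` spanning subsets
(p4, gen 17; paper proofs/P4-gen17.md §3, THEOREM Q; part A holds LEMMA Q)

`card_spanF_ge_quart`: a rank-`q` set `B` of `q + ν` elements (every circuit of `≥ 3` elements, every rank-`2` set of
`≤ 3` points, every rank-`≤ 3` set of `≤ 6` points) has `≥ ν + 3·C(ν, 2) + 3·C(ν, 3) + 2·C(ν, 4)` spanning
`(q+1)`-subsets — the sets `(I ∖ P) ∪ T` for `T ⊆ B ∖ I` of `1`, `2`, `3`, `4` elements and good `P ⊆ I`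
(`1`, `≥ 3`, `≥ 3`, `≥ 2` per `T`: S2CubeMultiplicity's three families and the quadruples of
`two_le_card_filter_good_triples`). It sharpens `card_spanF_ge_cube` by the quartic term. Axioms: standard.
-/

open scoped Matroid

namespace PercRepro

namespace S2

open Set

variable {α : Type} {M : Matroid α}

open scoped Classical in
/-- **THE QUARTIC MULTIPLICITY**: a rank-`q` set `B` of `m = q + ν` elements (every circuit of `≥ 3` elements, every
rank-`2` set of `≤ 3` points, every rank-`≤ 3` set of `≤ 6` points) has at least
`ν + 3·C(ν, 2) + 3·C(ν, 3) + 2·C(ν, 4)` spanning `(q+1)`-subsets — the sets `(I ∖ P) ∪ T` with `T ⊆ B ∖ I` of `1`, `2`,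
`3` or `4` elements and `P ⊆ I` of one element less, `P` «good» (`I ⊆ cl((I ∖ P) ∪ T)`): `1` per single, `≥ 3` per
pair, `≥ 3` per triple, `≥ 2` per quadruple (`two_le_card_filter_good_triples`). -/
theorem card_spanF_ge_quart [M.Finite] (q : ℕ) (_hq : 1 ≤ q) (hcirc : ∀ C, M.IsCircuit C → 3 ≤ C.encard)
    (hC1 : ∀ L ⊆ M.E, M.eRk L = 2 → L.ncard ≤ 3) (hC2 : ∀ L ⊆ M.E, M.eRk L ≤ 3 → L.ncard ≤ 6)
    {B : Finset α} (hBE : (B : Set α) ⊆ M.E) (hBq : M.eRk (B : Set α) = (q : ℕ∞)) :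
    (B.card - q) + 3 * (B.card - q).choose 2 + 3 * (B.card - q).choose 3 + 2 * (B.card - q).choose 4 ≤
      (spanF M q B).card := by
  obtain ⟨I₀, hI₀⟩ := M.exists_isBasis (B : Set α) hBE
  have hI₀fin : I₀.Finite := B.finite_toSet.subset hI₀.subset
  set I : Finset α := hI₀fin.toFinset with hIdef
  have hIcoe : (I : Set α) = I₀ := Set.Finite.coe_toFinset _
  have hIB : I ⊆ B := by
    intro x hx
    rw [hIdef, Set.Finite.mem_toFinset] at hx
    exact_mod_cast hI₀.subset hx
  have hIcard : I.card = q := by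
    have h := hI₀.encard_eq_eRk
    rw [hBq, ← hI₀fin.cast_ncard_eq] at h
    have h' : I₀.ncard = q := by exact_mod_cast h
    rw [hIdef, ← Set.ncard_eq_toFinset_card _ hI₀fin]; exact h'
  have hIind : M.Indep (I : Set α) := by rw [hIcoe]; exact hI₀.indep
  have hIE : (I : Set α) ⊆ M.E := hIind.subset_ground
  have hBcl : (B : Set α) ⊆ M.closure (I : Set α) := by rw [hIcoe]; exact hI₀.subset_closure
  set X : Finset α := B \ I with hXdef
  have hXcard : X.card = B.card - q := by
    rw [hXdef, Finset.card_sdiff_of_subset hIB, hIcard]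
  have hXI : ∀ x ∈ X, x ∉ I := fun x hx => (Finset.mem_sdiff.1 hx).2
  have hXB : ∀ x ∈ X, x ∈ B := fun x hx => (Finset.mem_sdiff.1 hx).1
  have hXcl : ∀ x ∈ X, x ∈ M.closure (I : Set α) := fun x hx => hBcl (by exact_mod_cast hXB x hx)
  have hXE : ∀ x ∈ X, x ∈ M.E := fun x hx => hBE (by exact_mod_cast hXB x hx)
  -- the index family: `(T, P)` with `T ⊆ X` of `1`, `2`, `3`, `4` elements, `P ⊆ I` of `|T| − 1` elements, `P` good
  set good : Finset α → Finset α → Prop :=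
    fun T P => (I : Set α) ⊆ M.closure (((I : Set α) \ (P : Set α)) ∪ (T : Set α)) with hgood
  set Ts : Finset (Finset α) :=
    X.powersetCard 1 ∪ X.powersetCard 2 ∪ X.powersetCard 3 ∪ X.powersetCard 4 with hTs
  set S : Finset (Σ _ : Finset α, Finset α) :=
    Ts.sigma (fun T => (I.powersetCard (T.card - 1)).filter (fun P => good T P)) with hS
  set gmap : (Σ _ : Finset α, Finset α) → Set α := fun s => (((I \ s.2) ∪ s.1 : Finset α) : Set α) with hgmap
  have hTsX : ∀ T ∈ Ts, T ⊆ X ∧ 1 ≤ T.card := by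
    intro T hT
    rw [hTs, Finset.mem_union, Finset.mem_union, Finset.mem_union, Finset.mem_powersetCard,
      Finset.mem_powersetCard, Finset.mem_powersetCard, Finset.mem_powersetCard] at hT
    rcases hT with ((h | h) | h) | h
    · exact ⟨h.1, by omega⟩
    · exact ⟨h.1, by omega⟩
    · exact ⟨h.1, by omega⟩
    · exact ⟨h.1, by omega⟩
  have hSdata : ∀ s ∈ S, s.1 ⊆ X ∧ 1 ≤ s.1.card ∧ s.2 ⊆ I ∧ s.2.card = s.1.card - 1 ∧ good s.1 s.2 := by
    intro s hs
    rw [hS, Finset.mem_sigma, Finset.mem_filter, Finset.mem_powersetCard] at hs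
    obtain ⟨hT, ⟨hP, hPc⟩, hg⟩ := hs
    exact ⟨(hTsX _ hT).1, (hTsX _ hT).2, hP, hPc, hg⟩
  -- (1) every indexed set is a spanning `(q+1)`-subset
  have hsub : S.image gmap ⊆ spanF M q B := by
    intro D hD
    rw [Finset.mem_image] at hD
    obtain ⟨s, hs, rfl⟩ := hD
    obtain ⟨hTX, hT1, hPI, hPc, hg⟩ := hSdata s hs
    have hTI : ∀ t ∈ s.1, t ∉ I := fun t ht => hXI t (hTX ht)
    have hdisj : Disjoint (I \ s.2) s.1 := by
      rw [Finset.disjoint_left]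
      intro a ha ha'
      exact hTI a ha' (Finset.mem_sdiff.1 ha).1
    have hDB : (I \ s.2) ∪ s.1 ⊆ B :=
      Finset.union_subset (Finset.sdiff_subset.trans hIB) (hTX.trans Finset.sdiff_subset)
    have hcoe : (((I \ s.2) ∪ s.1 : Finset α) : Set α) = ((I : Set α) \ (s.2 : Set α)) ∪ (s.1 : Set α) := by
      push_cast; rfl
    have hcl : (B : Set α) ⊆ M.closure (((I \ s.2) ∪ s.1 : Finset α) : Set α) := by
      rw [hcoe]
      exact hBcl.trans (M.closure_subset_closure_of_subset_closure hg)
    rw [mem_spanF]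
    refine ⟨(I \ s.2) ∪ s.1, hDB, ?_, ?_, hcl, rfl⟩
    · have hPle : s.2.card ≤ I.card := Finset.card_le_card hPI
      rw [Finset.card_union_of_disjoint hdisj, Finset.card_sdiff_of_subset hPI, hIcard, hPc]
      rw [hIcard] at hPle
      omega
    · exact eRk_eq_of_subset_of_subset_closure (by exact_mod_cast hDB) hBq hcl
  -- (2) the indexing is injective: `T = D ∖ I`, `P = I ∖ D`
  have hinj : Set.InjOn gmap (S : Set (Σ _ : Finset α, Finset α)) := by
    intro s hs s' hs' h
    obtain ⟨hTX, -, hPI, -, -⟩ := hSdata s (Finset.mem_coe.1 hs)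
    obtain ⟨hTX', -, hPI', -, -⟩ := hSdata s' (Finset.mem_coe.1 hs')
    have h' : ((I \ s.2) ∪ s.1 : Finset α) = (I \ s'.2) ∪ s'.1 := Finset.coe_inj.1 h
    have r1 := sdiff_union_recover (I := I) (fun t ht => hXI t (hTX ht)) hPI
    have r2 := sdiff_union_recover (I := I) (fun t ht => hXI t (hTX' ht)) hPI'
    have hT : s.1 = s'.1 := by rw [← r1.1, h', r2.1]
    have hP : s.2 = s'.2 := by rw [← r1.2, h', r2.2]
    exact Sigma.ext hT (heq_of_eq hP)
  have hcardS : S.card ≤ (spanF M q B).card := by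
    calc S.card = (S.image gmap).card := (Finset.card_image_of_injOn hinj).symm
      _ ≤ (spanF M q B).card := Finset.card_le_card hsub
  -- (3) the count of the index family
  have hcount : X.card + 3 * X.card.choose 2 + 3 * X.card.choose 3 + 2 * X.card.choose 4 ≤ S.card := by
    rw [hS, Finset.card_sigma]
    have hd1 : Disjoint (X.powersetCard 1) (X.powersetCard 2) := by
      rw [Finset.disjoint_left]
      intro T h1 h2
      rw [Finset.mem_powersetCard] at h1 h2
      omega
    have hd2 : Disjoint (X.powersetCard 1 ∪ X.powersetCard 2) (X.powersetCard 3) := by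
      rw [Finset.disjoint_left]
      intro T h1 h2
      rw [Finset.mem_union, Finset.mem_powersetCard, Finset.mem_powersetCard] at h1
      rw [Finset.mem_powersetCard] at h2
      omega
    have hd3 : Disjoint (X.powersetCard 1 ∪ X.powersetCard 2 ∪ X.powersetCard 3) (X.powersetCard 4) := by
      rw [Finset.disjoint_left]
      intro T h1 h2
      rw [Finset.mem_union, Finset.mem_union, Finset.mem_powersetCard, Finset.mem_powersetCard,
        Finset.mem_powersetCard] at h1
      rw [Finset.mem_powersetCard] at h2
      omega
    rw [hTs, Finset.sum_union hd3, Finset.sum_union hd2, Finset.sum_union hd1]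
    -- singles: exactly one good `P = ∅`
    have h1 : ∀ T ∈ X.powersetCard 1,
        1 ≤ ((I.powersetCard (T.card - 1)).filter (fun P => good T P)).card := by
      intro T hT
      rw [Finset.mem_powersetCard] at hT
      refine Finset.card_pos.2 ⟨∅, ?_⟩
      rw [Finset.mem_filter, Finset.mem_powersetCard, hT.2]
      refine ⟨⟨Finset.empty_subset _, Finset.card_empty⟩, ?_⟩
      rw [hgood]
      simp only [Finset.coe_empty, Set.sdiff_empty]
      exact (M.subset_closure _ hIE).trans (M.closure_subset_closure Set.subset_union_left)
    -- pairs: three exchange points (p7)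
    have h2 : ∀ T ∈ X.powersetCard 2,
        3 ≤ ((I.powersetCard (T.card - 1)).filter (fun P => good T P)).card := by
      intro T hT
      rw [Finset.mem_powersetCard] at hT
      obtain ⟨x, y, hxy, rfl⟩ := Finset.card_eq_two.1 hT.2
      have hxX : x ∈ X := hT.1 (Finset.mem_insert_self x {y})
      have hyX : y ∈ X := hT.1 (Finset.mem_insert_of_mem (Finset.mem_singleton_self y))
      have h3 := three_le_card_filter_pair hcirc hC1 hIind hIE (hXcl x hxX) (hXI x hxX) (hXcl y hyX) (hXI y hyX)
        hxy (hXE x hxX) (hXE y hyX)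
      refine h3.trans ?_
      refine Finset.card_le_card_of_injOn (fun z => ({z} : Finset α)) ?_ ?_
      · intro z hz
        rw [Finset.mem_coe, Finset.mem_filter] at hz
        rw [Finset.mem_coe, Finset.mem_filter, Finset.mem_powersetCard, Finset.card_pair hxy]
        refine ⟨⟨Finset.singleton_subset_iff.2 hz.1, Finset.card_singleton z⟩, ?_⟩
        rw [hgood]
        -- `z` is recovered by the extra whose circuit contains it; the rest of `I` is there
        have hrec : ∀ t ∈ ({x, y} : Finset α), z ∈ M.fundCircuit t (I : Set α) →
            z ∈ M.closure (((I : Set α) \ ({z} : Finset α)) ∪ (({x, y} : Finset α) : Set α)) := by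
          intro t ht hzt
          have htX : t ∈ X := hT.1 ht
          have h := mem_closure_insert_of_mem_fundCircuit hIind (hXcl t htX) (hXI t htX) (by exact_mod_cast hz.1) hzt
          refine M.closure_subset_closure ?_ h
          intro a ha
          rcases ha with rfl | ha
          · exact Or.inr (by exact_mod_cast ht)
          · exact Or.inl (by simpa using ha)
        intro a ha
        by_cases haz : a = z
        · rw [haz]
          rcases hz.2 with h | h
          · exact hrec x (Finset.mem_insert_self x {y}) h
          · exact hrec y (Finset.mem_insert_of_mem (Finset.mem_singleton_self y)) h
        · exact M.mem_closure_of_mem (Or.inl ⟨ha, by simpa using haz⟩)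
            (Set.union_subset (Set.sdiff_subset.trans hIE) (by
              intro b hb
              exact hXE b (hT.1 (by exact_mod_cast hb))))
      · intro z _ z' _ h
        exact Finset.singleton_inj.1 h
    -- triples: three good pairs
    have h3 : ∀ T ∈ X.powersetCard 3,
        3 ≤ ((I.powersetCard (T.card - 1)).filter (fun P => good T P)).card := by
      intro T hT
      rw [Finset.mem_powersetCard] at hT
      obtain ⟨e, f, g, hef, heg, hfg, rfl⟩ := Finset.card_eq_three.1 hT.2
      have heX : e ∈ X := hT.1 (by simp)
      have hfX : f ∈ X := hT.1 (by simp)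
      have hgX : g ∈ X := hT.1 (by simp)
      have h := three_le_card_filter_good_pairs hcirc hC1 hIind hIE (hXcl e heX) (hXcl f hfX) (hXcl g hgX)
        (hXI e heX) (hXI f hfX) (hXI g hgX) hef heg hfg
      rw [Finset.card_eq_three.2 ⟨e, f, g, hef, heg, hfg, rfl⟩]
      refine h.trans (le_of_eq ?_)
      congr 1
      apply Finset.filter_congr
      intro P _
      rw [hgood]
      simp only [Finset.coe_insert, Finset.coe_singleton]
    -- quadruples: two good triples
    have h4 : ∀ T ∈ X.powersetCard 4,
        2 ≤ ((I.powersetCard (T.card - 1)).filter (fun P => good T P)).card := by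
      intro T hT
      rw [Finset.mem_powersetCard] at hT
      obtain ⟨e, f, g, h, hef, heg, heh, hfg, hfh, hgh, rfl⟩ := Finset.card_eq_four.1 hT.2
      have heX : e ∈ X := hT.1 (by simp)
      have hfX : f ∈ X := hT.1 (by simp)
      have hgX : g ∈ X := hT.1 (by simp)
      have hhX : h ∈ X := hT.1 (by simp)
      have h2 := two_le_card_filter_good_triples hcirc hC1 hC2 hIind hIE (hXcl e heX) (hXcl f hfX) (hXcl g hgX)
        (hXcl h hhX) (hXI e heX) (hXI f hfX) (hXI g hgX) (hXI h hhX) hef heg heh hfg hfh hgh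
      rw [Finset.card_eq_four.2 ⟨e, f, g, h, hef, heg, heh, hfg, hfh, hgh, rfl⟩]
      refine h2.trans (le_of_eq ?_)
      congr 1
      apply Finset.filter_congr
      intro P _
      rw [hgood]
      simp only [Finset.coe_insert, Finset.coe_singleton]
    calc X.card + 3 * X.card.choose 2 + 3 * X.card.choose 3 + 2 * X.card.choose 4
        = ∑ _T ∈ X.powersetCard 1, 1 + ∑ _T ∈ X.powersetCard 2, 3 + ∑ _T ∈ X.powersetCard 3, 3 +
            ∑ _T ∈ X.powersetCard 4, 2 := by
          rw [Finset.sum_const, Finset.sum_const, Finset.sum_const, Finset.sum_const, Finset.card_powersetCard,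
            Finset.card_powersetCard, Finset.card_powersetCard, Finset.card_powersetCard, smul_eq_mul, smul_eq_mul,
            smul_eq_mul, smul_eq_mul, Nat.choose_one_right]
          ring
      _ ≤ _ := add_le_add (add_le_add (add_le_add (Finset.sum_le_sum h1) (Finset.sum_le_sum h2))
          (Finset.sum_le_sum h3)) (Finset.sum_le_sum h4)
  rw [← hXcard]
  exact hcount.trans hcardS

end S2

end PercRepro
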